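import Literature.Analysis.FluidPDE.FluidComputer.ThresholdLevelTableU
import HarnessLib

/-!
# Kernel run of the re-cut table over the 10⁻² box, chunks 48 … 51 (bp3 gen 13, layer 4: robustness variant U)

HONEST FRAMING: low prior, high value-of-information experiment on Tao's machine paradigm; NOT a
claim that NS blows up.

Four kernel evaluations (`decide +kernel`; no `native_decide`, no extra axioms) of the checker
`runSteps` (`ThresholdLevelCheck.lean`) with the interval gate data `GIu` (all seven data within
relative `10⁻²`) on ≤ 25 steps of `ThresholdLevelTableU.stepsU` at a time, from `Bu i` towards the next chunk's
first level, returning `Bu (i+1)` (`Bu 0 = ThresholdLevelTable.Bc0`).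
-/

namespace Literature.Analysis.FluidPDE.FluidComputer

namespace ThresholdLevelTableU

open ThresholdLevelTable (Bc0 RbIt)

set_option maxHeartbeats 10000000 in
set_option maxRecDepth 200000 in
/-- Chunk 48 of the re-cut table run over the 10⁻² box (steps 1200 … 1224). [folklore] -/
theorem runU48 : runSteps 60 12 3 GIu RbIt Bu48 chunkU48 33508022620081206 = some Bu49 := by
  decide +kernel

set_option maxHeartbeats 10000000 in
set_option maxRecDepth 200000 in
/-- Chunk 49 of the re-cut table run over the 10⁻² box (steps 1225 … 1249). [folklore] -/
theorem runU49 : runSteps 60 12 3 GIu RbIt Bu49 chunkU49 36555230506079184 = some Bu50 := by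
  decide +kernel

set_option maxHeartbeats 10000000 in
set_option maxRecDepth 200000 in
/-- Chunk 50 of the re-cut table run over the 10⁻² box (steps 1250 … 1274). [folklore] -/
theorem runU50 : runSteps 60 12 3 GIu RbIt Bu50 chunkU50 39880033878065732 = some Bu51 := by
  decide +kernel

set_option maxHeartbeats 10000000 in
set_option maxRecDepth 200000 in
/-- Chunk 51 of the re-cut table run over the 10⁻² box (steps 1275 … 1299). [folklore] -/
theorem runU51 : runSteps 60 12 3 GIu RbIt Bu51 chunkU51 43506710244646736 = some Bu52 := by
  decide +kernel

end ThresholdLevelTableU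

end Literature.Analysis.FluidPDE.FluidComputer
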